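import Literature.AlgebraicGeometry.Deligne1982.WeilTypeCMWeilClassesHodge
import Literature.AlgebraicGeometry.HodgeTheory.WeilClassesMoonenZarhinCriterionHolds
import Literature.AlgebraicGeometry.HodgeTheory.WeilTypeProducts
import Literature.AlgebraicGeometry.HodgeTheory.WeilTypeIsogenyClassSquares
import Literature.AlgebraicGeometry.HodgeTheory.StablyNondegenerateProducts
import Literature.AlgebraicGeometry.ComplexMultiplication.EndomorphismFieldNondegenerateType
import HarnessLib

/-!
# Ring 2 · AbelianAll — ANDRÉ AXIS, PART S-c: THE CM-FIELD TWISTED SQUARE `T × T̄` IS OF WEIL TYPE RELATIVE TO `E` — for EVERY complex abelian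
  variety `T` with multiplication by a CM field `E = ℚ(η) ≅ ℚ[T]/(R(T²))` (ANY multiplicities of `E` on `H^{1,0}(T)`, `dim T = k·[E⁺:ℚ]`),
  the pair `(T × T, η × (−η))` satisfies Deligne's (4.4) `a_σ = k` at every embedding; when the Hodge conjecture holds for `T × T`
  (e.g. `T = S × S` with `S` stably nondegenerate) all of its `E`-Weil classes are algebraic (abelian-variety level; fact-free)

HONEST FRAMING (page 1, verbatim): **research route, not a corollary; conditional on HC_CM plus one named minimal statement.** Cell line:
research route conditional on HC_CM; not a corollary; Q11.4-sentence-2 already refuted in dim ≥ 3. `HC_CM`, `HC_AV` and the global nodes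
do NOT occur in this file; no pencil occurs. Nothing here is a case of the Hodge conjecture beyond what the tree proves outright (powers of a
stably nondegenerate abelian variety); no definition, no named fact, no `sorry`. Seat `pub-hodge-ring2-ab-andre-2`, gen 49 (part S: CM-field
component anchors and twisted squares; owed item (o156)). Part O-a (gen 45, `…AndreTwistedSquareAnchors`) proved the imaginary-quadratic
case in van Geemen's language (`isWeilType_twistedSquare`: `(T × T, φ × (−φ))` is of Weil type `(g, d)`), through a non-zero ALGEBRAIC class on
the Weil line; here `E` is a CM field of any degree `2e₀` and «Weil type» is Deligne's (4.4) on the carriers (`Deligne1982.IsWeilTypeCM`), proved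
by COUNTING MULTIPLICITIES: `a_σ(T × T̄) = a_σ(T) + a_σ̄(T) = dim_E H¹(T) = k` (Moonen–Zarhin's `n_σ + n_σ̄ = 2g/[E:ℚ]`, a tree theorem).
The CorCM / ring2-b03 files prove the same conclusion for PRODUCTS OF CM-TYPE REALISATIONS with André's constant-sum condition
(`AndreSplit.isWeilTypeCM_diagHom`, `WeilCoverageCM.isWeilTypeCM_diagHom'`: slots of `E`-rank one, a ring-of-integers action, a CM type per
slot); the present statement is presentation-free — one endomorphism `η` with `R(η²) = 0`, any `T`.

## Content (theorems only; standard axioms)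

* §1 `eval₂_prodLift_map` — polynomials in a product endomorphism are computed factor by factor:
  `Q(α × β) = Q(α) × Q(β)` in `End(A × B)` (the block-diagonal ring homomorphism `End A × End B → End(A × B)`);
  `eval₂_neg_comp_X_sq` — an even polynomial takes the same value at `η` and `−η`: `R((−η)²) = R(η²)`.
* §2 **`eigenMultiplicity_twistedSquare`** — `a_ρ(T × T, η × (−η)) = a_ρ(T, η) + a_{−ρ}(T, η)` for every `ρ ∈ ℂ` (Künneth in degree one with
  Hodge types, the tree's `finrank_eigenspace_inf_hodgeOneZero_prod`, and `ker((−η)^* − ρ) = ker(η^* + ρ)`).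
* §3 **`isWeilTypeCM_twistedSquare`** — THE THEOREM: `R ∈ ℤ[S]` monic of degree `e₀ ≥ 1` with all roots real negative and `R(T²)` irreducible
  over `ℚ` (so `E = ℚ[T]/(R(T²))` is a CM field, `η̄ = −η`), `T` a complex abelian variety of dimension `k·e₀` (`k ≥ 1`) with `η : T ⟶ T`,
  `R(η²) = 0` ⟹ **`IsWeilTypeCM (T × T) (η × (−η)) R e₀ k`**: `R((η × (−η))²) = R(η²) × R(η²) = 0`, `dim (T × T) = 2k·e₀`, and at every root
  `ρ` of `R(T²)` (`ρ̄ = −ρ`) `a_ρ(T × T̄) = a_ρ(T) + a_{ρ̄}(T) = k` (Moonen–Zarhin: `n_ρ + n_ρ̄ = 2 dim T/[E:ℚ]`,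
  `eigenMultiplicity_add_eigenMultiplicity_conj_eq`). NO hypothesis on the multiplicities of `(T, η)`. `isWeilTypeCM_twistedSquare_of_isWeilTypeCM`:
  `T` itself of Weil type `(R, e₀, k)` ⟹ `T × T̄` of Weil type `(R, e₀, 2k)`.
* §4 **`weilClassesField_twistedSquare_le_algebraicClasses_of_hodgeConjectureFor`** — if moreover the Hodge conjecture holds for `T × T`, ALL of
  `W_E(T × T̄) ⊗ ℂ ⊆ H^{2k}` is algebraic (the Weil classes are of type `(k, k)` by Deligne's Prop. 4.4 ⟸ — the tree's Moonen–Zarhin criterion — and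
  span a rational space); **`isWeilTypeCM_and_hodge_twistedSquare_prod_of_isStablyNondegenerate`** — the CM-field `B × B̄` IN CODIMENSION TWO: for
  `S` STABLY NONDEGENERATE of dimension `e₀` with `R(η_S²) = 0` (a simple CM abelian variety of PRIME dimension `e₀` with CM by `E`, Yanai /
  `EndFieldFullDegree.isStablyNondegenerate_of_prime` — `…_of_endField_prime`), the `4e₀`-fold `(S × S) × (S × S)‾` with `(η ⊕ η) × (−(η ⊕ η))` is of
  Weil type `(R, e₀, 2)`, satisfies the Hodge conjecture (`(S²)² ∼ S⁴`, tree), and has algebraic `E`-Weil classes `W_E ⊂ H⁴` (codimension 2).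
  Smallest: `e₀ = 2` — `S` a simple CM abelian SURFACE with quartic CM field `E` (Galois or not): the EIGHTFOLD `S² × S̄²`.

## Honest status

Abelian-variety level, fact-free. The CM-field components `(R, e₀, k, δ)` (`Ring2.Hypotheses.WeilClassesComponentCM`) met by these twisted
squares are NOT determined here (no discriminant is computed: the CM-field analogue of part O-a §4 / ring2-b03's `HasWeilDiscriminantCM` rows for
`B^p × (B^ρ)^p` is not redone); for the δ-indexed anchors the André rows of part S-b use ring2-b03's CM power members. The role of this file: the
Weil type of the twisted-square SHAPE for an arbitrary `(T, η)` — the member hypothesis of part R-b's rows at a twisted-square chart (part S-d).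
Nothing minimal claimed; N104 untouched. EDGE LABELS: all theorems K (fact-free).
References: Deligne1982HodgeCycles (§4 (4.4), Prop. 4.4, Remark 4.10, §5 (c) p. 38 «`a_s = Σᵢ Φᵢ(s)`»); MoonenZarhin1998WeilClasses (§1,
`n_σ + n_σ' = 2g/[F:ℚ]`, Criterion); vanGeemen1994HodgeAV (4.9, proof of Lemma 5.2 (3)); Gordon1999HodgeAVSurvey (Thm. 6.3, Def. 7.6); Yanai1985.
-/

noncomputable section

set_option linter.dupNamespace false

namespace Summit.HodgeConjecture.HodgeConjecture.Ring2.AbelianAll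

open CategoryTheory Polynomial
open Literature.AlgebraicTopology.SingularHomology
open Literature.AlgebraicGeometry Literature.AlgebraicGeometry.Motives
open Literature.AlgebraicGeometry.HodgeTheory Literature.AlgebraicGeometry.Deligne1982
open Literature.AlgebraicGeometry.ComplexMultiplication (EndFieldFullDegree.isStablyNondegenerate_of_prime)

/-! ## §1 Polynomials in a product endomorphism; even polynomials at `−η` -/

section Algebra

variable {A B : AbelianVariety ℂ}

/-- `(α × β) ≫ (α' × β') = (α ≫ α') × (β ≫ β')` on `A × B`. [folklore] -/
theorem prodLift_map_comp_prodLift_map (α α' : A ⟶ A) (β β' : B ⟶ B) :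
    AbelianVariety.prodLift (AbelianVariety.fst A B ≫ α) (AbelianVariety.snd A B ≫ β) ≫
        AbelianVariety.prodLift (AbelianVariety.fst A B ≫ α') (AbelianVariety.snd A B ≫ β') =
      AbelianVariety.prodLift (AbelianVariety.fst A B ≫ α ≫ α') (AbelianVariety.snd A B ≫ β ≫ β') :=
  AbelianVariety.prod_hom_ext
    (by simp only [Category.assoc, AbelianVariety.prodLift_fst, AbelianVariety.prodLift_fst_assoc])
    (by simp only [Category.assoc, AbelianVariety.prodLift_snd, AbelianVariety.prodLift_snd_assoc])

/-- Integer polynomials are evaluated componentwise in a product ring (first component). [folklore] -/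
theorem fst_eval₂_intCast {S₁ S₂ : Type*} [Ring S₁] [Ring S₂] (x : S₁ × S₂) (Q : Polynomial ℤ) :
    (Polynomial.eval₂ (Int.castRingHom (S₁ × S₂)) x Q).1 = Polynomial.eval₂ (Int.castRingHom S₁) x.1 Q := by
  have h := Polynomial.hom_eval₂ Q (Int.castRingHom (S₁ × S₂)) (RingHom.fst S₁ S₂) x
  rw [RingHom.ext_int ((RingHom.fst S₁ S₂).comp (Int.castRingHom (S₁ × S₂))) (Int.castRingHom S₁)] at h
  exact h

/-- Integer polynomials are evaluated componentwise in a product ring (second component). [folklore] -/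
theorem snd_eval₂_intCast {S₁ S₂ : Type*} [Ring S₁] [Ring S₂] (x : S₁ × S₂) (Q : Polynomial ℤ) :
    (Polynomial.eval₂ (Int.castRingHom (S₁ × S₂)) x Q).2 = Polynomial.eval₂ (Int.castRingHom S₂) x.2 Q := by
  have h := Polynomial.hom_eval₂ Q (Int.castRingHom (S₁ × S₂)) (RingHom.snd S₁ S₂) x
  rw [RingHom.ext_int ((RingHom.snd S₁ S₂).comp (Int.castRingHom (S₁ × S₂))) (Int.castRingHom S₂)] at h
  exact h

/-- **An even polynomial takes the same value at `x` and `−x`**: `R((−x)²) = R(x²)` in any ring (integer scalars are central, so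
composite polynomials evaluate by substitution, Mathlib's `eval₂_comp'`). [folklore] -/
theorem eval₂_neg_comp_X_sq_ring {S : Type*} [Ring S] (x : S) (R : Polynomial ℤ) :
    Polynomial.eval₂ (Int.castRingHom S) (-x) (R.comp (X ^ 2)) = Polynomial.eval₂ (Int.castRingHom S) x (R.comp (X ^ 2)) := by
  rw [← algebraMap_int_eq, Polynomial.eval₂_comp', Polynomial.eval₂_comp', Polynomial.eval₂_pow', Polynomial.eval₂_pow',
    Polynomial.eval₂_X, Polynomial.eval₂_X, neg_sq]

/-- **Polynomials in a product endomorphism are computed factor by factor**: for `Q ∈ ℤ[X]`,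
`Q(α × β) = Q(α) × Q(β)` in `End(A × B)` (`(a, b) ↦ a × b` is a ring homomorphism `End A × End B → End(A × B)`, and integer
polynomials commute with ring homomorphisms). [folklore] [cite: MumfordAV1970, §19 (p. 173)] -/
theorem eval₂_prodLift_map (α : A ⟶ A) (β : B ⟶ B) (Q : Polynomial ℤ) :
    Polynomial.eval₂ (Int.castRingHom (CategoryTheory.End (A.prod B)))
        ((AbelianVariety.prodLift (AbelianVariety.fst A B ≫ α) (AbelianVariety.snd A B ≫ β) :
          CategoryTheory.End (A.prod B))) Q =
      CategoryTheory.End.of (AbelianVariety.prodLift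
        (AbelianVariety.fst A B ≫ CategoryTheory.End.asHom
          (Polynomial.eval₂ (Int.castRingHom (CategoryTheory.End A)) (α : CategoryTheory.End A) Q))
        (AbelianVariety.snd A B ≫ CategoryTheory.End.asHom
          (Polynomial.eval₂ (Int.castRingHom (CategoryTheory.End B)) (β : CategoryTheory.End B) Q))) := by
  -- the block-diagonal ring homomorphism `(a, b) ↦ a × b`
  let δ : (CategoryTheory.End A × CategoryTheory.End B) →+* CategoryTheory.End (A.prod B) :=
    { toFun := fun p => CategoryTheory.End.of
        (AbelianVariety.prodLift (AbelianVariety.fst A B ≫ CategoryTheory.End.asHom p.1)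
          (AbelianVariety.snd A B ≫ CategoryTheory.End.asHom p.2))
      map_one' := by
        show (AbelianVariety.prodLift (AbelianVariety.fst A B ≫ 𝟙 A) (AbelianVariety.snd A B ≫ 𝟙 B) :
            A.prod B ⟶ A.prod B) = 𝟙 (A.prod B)
        exact AbelianVariety.prod_hom_ext
          (by rw [AbelianVariety.prodLift_fst, Category.comp_id, Category.id_comp])
          (by rw [AbelianVariety.prodLift_snd, Category.comp_id, Category.id_comp])
      map_mul' := fun p q => by
        show (AbelianVariety.prodLift
              (AbelianVariety.fst A B ≫ CategoryTheory.End.asHom q.1 ≫ CategoryTheory.End.asHom p.1)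
              (AbelianVariety.snd A B ≫ CategoryTheory.End.asHom q.2 ≫ CategoryTheory.End.asHom p.2) :
            A.prod B ⟶ A.prod B) =
          AbelianVariety.prodLift (AbelianVariety.fst A B ≫ CategoryTheory.End.asHom q.1)
              (AbelianVariety.snd A B ≫ CategoryTheory.End.asHom q.2) ≫
            AbelianVariety.prodLift (AbelianVariety.fst A B ≫ CategoryTheory.End.asHom p.1)
              (AbelianVariety.snd A B ≫ CategoryTheory.End.asHom p.2)
        rw [prodLift_map_comp_prodLift_map]
      map_zero' := by
        show (AbelianVariety.prodLift (AbelianVariety.fst A B ≫ (0 : A ⟶ A)) (AbelianVariety.snd A B ≫ (0 : B ⟶ B)) :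
            A.prod B ⟶ A.prod B) = 0
        exact AbelianVariety.prod_hom_ext
          (by rw [AbelianVariety.prodLift_fst, Limits.comp_zero, Limits.zero_comp])
          (by rw [AbelianVariety.prodLift_snd, Limits.comp_zero, Limits.zero_comp])
      map_add' := fun p q => by
        show (AbelianVariety.prodLift
              (AbelianVariety.fst A B ≫ (CategoryTheory.End.asHom p.1 + CategoryTheory.End.asHom q.1))
              (AbelianVariety.snd A B ≫ (CategoryTheory.End.asHom p.2 + CategoryTheory.End.asHom q.2)) :
            A.prod B ⟶ A.prod B) =
          AbelianVariety.prodLift (AbelianVariety.fst A B ≫ CategoryTheory.End.asHom p.1)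
              (AbelianVariety.snd A B ≫ CategoryTheory.End.asHom p.2) +
            AbelianVariety.prodLift (AbelianVariety.fst A B ≫ CategoryTheory.End.asHom q.1)
              (AbelianVariety.snd A B ≫ CategoryTheory.End.asHom q.2)
        exact AbelianVariety.prod_hom_ext
          (by rw [AbelianVariety.prodLift_fst, Preadditive.comp_add, Preadditive.add_comp,
            AbelianVariety.prodLift_fst, AbelianVariety.prodLift_fst])
          (by rw [AbelianVariety.prodLift_snd, Preadditive.comp_add, Preadditive.add_comp,
            AbelianVariety.prodLift_snd, AbelianVariety.prodLift_snd]) }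
  have hδ : ∀ p : CategoryTheory.End A × CategoryTheory.End B,
      δ p = CategoryTheory.End.of (AbelianVariety.prodLift (AbelianVariety.fst A B ≫ CategoryTheory.End.asHom p.1)
        (AbelianVariety.snd A B ≫ CategoryTheory.End.asHom p.2)) := fun _ => rfl
  -- transport through `δ`
  have h := Polynomial.hom_eval₂ Q (Int.castRingHom (CategoryTheory.End A × CategoryTheory.End B)) δ
    ((α : CategoryTheory.End A), (β : CategoryTheory.End B))
  rw [RingHom.ext_int (δ.comp (Int.castRingHom (CategoryTheory.End A × CategoryTheory.End B)))
    (Int.castRingHom (CategoryTheory.End (A.prod B))), hδ, hδ, fst_eval₂_intCast, snd_eval₂_intCast] at h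
  exact h.symm

/-- **An even polynomial takes the same value at `η` and `−η`** in `End T`: `R((−η)²) = R(η²)`. [folklore] -/
theorem eval₂_neg_comp_X_sq (η : A ⟶ A) (R : Polynomial ℤ) :
    Polynomial.eval₂ (Int.castRingHom (CategoryTheory.End A)) ((-η : A ⟶ A) : CategoryTheory.End A) (R.comp (X ^ 2)) =
      Polynomial.eval₂ (Int.castRingHom (CategoryTheory.End A)) (η : CategoryTheory.End A) (R.comp (X ^ 2)) :=
  eval₂_neg_comp_X_sq_ring (S := CategoryTheory.End A) (η : CategoryTheory.End A) R

/-- Hence `R(η²) = 0 ⟹ R((−η)²) = 0`: the conjugate `E`-structure `ῑ = ι ∘ c` is again an `E`-structure. [cite: Deligne1982HodgeCycles, §4 p. 30] -/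
theorem eval₂_neg_comp_X_sq_eq_zero {η : A ⟶ A} {R : Polynomial ℤ}
    (hη : Polynomial.eval₂ (Int.castRingHom (CategoryTheory.End A)) (η : CategoryTheory.End A) (R.comp (X ^ 2)) = 0) :
    Polynomial.eval₂ (Int.castRingHom (CategoryTheory.End A)) ((-η : A ⟶ A) : CategoryTheory.End A) (R.comp (X ^ 2)) = 0 := by
  rw [eval₂_neg_comp_X_sq, hη]

/-- **`R((η × (−η))²) = 0` on `T × T`** whenever `R(η²) = 0` on `T`. [cite: Deligne1982HodgeCycles, §4 p. 30 and §5 (c) p. 38] -/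
theorem eval₂_twistedSquare_comp_X_sq_eq_zero {η : A ⟶ A} {R : Polynomial ℤ}
    (hη : Polynomial.eval₂ (Int.castRingHom (CategoryTheory.End A)) (η : CategoryTheory.End A) (R.comp (X ^ 2)) = 0) :
    Polynomial.eval₂ (Int.castRingHom (CategoryTheory.End (A.prod A)))
        ((AbelianVariety.prodLift (AbelianVariety.fst A A ≫ η) (AbelianVariety.snd A A ≫ (-η)) :
          CategoryTheory.End (A.prod A))) (R.comp (X ^ 2)) = 0 := by
  rw [eval₂_prodLift_map, hη, eval₂_neg_comp_X_sq_eq_zero hη]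
  show (AbelianVariety.prodLift (AbelianVariety.fst A A ≫ (0 : A ⟶ A)) (AbelianVariety.snd A A ≫ (0 : A ⟶ A)) :
      A.prod A ⟶ A.prod A) = 0
  exact AbelianVariety.prod_hom_ext
    (by rw [AbelianVariety.prodLift_fst, Limits.comp_zero, Limits.zero_comp])
    (by rw [AbelianVariety.prodLift_snd, Limits.comp_zero, Limits.zero_comp])

/-- The same for the DIAGONAL structure `η × η` on `A × A` (the `E`-action on `S × S` used in §4). [cite: Deligne1982HodgeCycles, §5 (c) p. 38] -/
theorem eval₂_diagSquare_comp_X_sq_eq_zero {η : A ⟶ A} {R : Polynomial ℤ}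
    (hη : Polynomial.eval₂ (Int.castRingHom (CategoryTheory.End A)) (η : CategoryTheory.End A) (R.comp (X ^ 2)) = 0) :
    Polynomial.eval₂ (Int.castRingHom (CategoryTheory.End (A.prod A)))
        ((AbelianVariety.prodLift (AbelianVariety.fst A A ≫ η) (AbelianVariety.snd A A ≫ η) :
          CategoryTheory.End (A.prod A))) (R.comp (X ^ 2)) = 0 := by
  rw [eval₂_prodLift_map, hη]
  show (AbelianVariety.prodLift (AbelianVariety.fst A A ≫ (0 : A ⟶ A)) (AbelianVariety.snd A A ≫ (0 : A ⟶ A)) :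
      A.prod A ⟶ A.prod A) = 0
  exact AbelianVariety.prod_hom_ext
    (by rw [AbelianVariety.prodLift_fst, Limits.comp_zero, Limits.zero_comp])
    (by rw [AbelianVariety.prodLift_snd, Limits.comp_zero, Limits.zero_comp])

end Algebra

/-! ## §2 The multiplicities of the twisted square -/

section Multiplicity

variable {T : AbelianVariety ℂ}

/-- **`a_ρ(T × T, η × (−η)) = a_ρ(T, η) + a_{−ρ}(T, η)`**: the multiplicity of `ρ` on `H^{1,0}` of the twisted square is the sum of the
multiplicities of `ρ` and `−ρ` on `H^{1,0}(T)` (Künneth in degree one with Hodge types: `V_ρ(T × T) ∩ H^{1,0} = pr₁^*(V_ρ(η) ∩ H^{1,0}) ⊕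
pr₂^*(V_ρ(−η) ∩ H^{1,0})`, the tree's `finrank_eigenspace_inf_hodgeOneZero_prod`, and `V_ρ(−η) = V_{−ρ}(η)`). In Deligne's words for a CM slot:
`a_s(A_Φ × A_Φ̄) = Φ(s) + Φ̄(s) = 1`. [cite: Deligne1982HodgeCycles, §5 (c) p. 38] [cite: vanGeemen1994HodgeAV, proof of Lemma 5.2 (3)] -/
theorem eigenMultiplicity_twistedSquare (η : T ⟶ T) (ρ : ℂ) :
    eigenMultiplicity (T.prod T)
        (AbelianVariety.prodLift (AbelianVariety.fst T T ≫ η) (AbelianVariety.snd T T ≫ (-η))) ρ =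
      eigenMultiplicity T η ρ + eigenMultiplicity T η (-ρ) := by
  have hdim : (T.prod T).dim = T.dim + T.dim := AbelianVariety.dim_prod T T
  have h := finrank_eigenspace_inf_hodgeOneZero_prod (A := T) (B := T) rfl rfl η (-η) ρ
  rw [eigenspace_map_neg_one_eq η ρ] at h
  unfold eigenMultiplicity
  rw [← hodgeOneZero_eq_of_dim_eq hdim (Motives.isSmoothProjective_of_dim_eq' hdim)
    (Motives.AbelianVariety.isSmoothProjective_holds (A := T.prod T))]
  exact h

end Multiplicity

/-! ## §3 The twisted square is of Weil type relative to `E` -/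

section WeilType

variable {T : AbelianVariety ℂ} {η : T ⟶ T} {R : Polynomial ℤ} {e₀ k : ℕ}

/-- The roots of `R(T²)` are purely imaginary when the roots of `R` are real and negative: `ρ̄ = −ρ` (the field-theoretic clause of
`IsWeilTypeCM.conj_eq_neg_of_root`, with the same proof, before any abelian variety is chosen). [cite: Deligne1982HodgeCycles, §4 p. 30] -/
theorem conj_eq_neg_of_root_of_roots_real_neg
    (hroots : ∀ s : ℂ, Polynomial.eval₂ (Int.castRingHom ℂ) s R = 0 → s.im = 0 ∧ s.re < 0) {ρ : ℂ}
    (hρ : Polynomial.eval₂ (Int.castRingHom ℂ) ρ (R.comp (X ^ 2)) = 0) : starRingEnd ℂ ρ = -ρ := by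
  rw [eval₂_comp_X_sq] at hρ
  obtain ⟨him, hre⟩ := hroots (ρ ^ 2) hρ
  rw [pow_two, Complex.mul_im] at him
  rw [pow_two, Complex.mul_re] at hre
  have hre0 : ρ.re = 0 := by
    rcases mul_eq_zero.1 (show ρ.re * ρ.im = 0 by linarith [him, mul_comm ρ.re ρ.im]) with h0 | h0
    · exact h0
    · exfalso
      rw [h0, mul_zero, sub_zero] at hre
      exact absurd hre (not_lt.2 (mul_self_nonneg _))
  apply Complex.ext
  · rw [Complex.conj_re, Complex.neg_re, hre0, neg_zero]
  · rw [Complex.conj_im, Complex.neg_im]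

/-- **THE CM-FIELD TWISTED SQUARE IS OF WEIL TYPE.** Let `R ∈ ℤ[S]` be monic of degree `e₀ ≥ 1` with all roots real and negative and `R(T²)`
irreducible over `ℚ` (`E = ℚ[T]/(R(T²))` a CM field of degree `2e₀`, `η̄ = −η`), and let `T` be a complex abelian variety of dimension `k·e₀`
(`k ≥ 1`) with an endomorphism `η` such that `R(η²) = 0` — ANY multiplicities of `E` on `H^{1,0}(T)`. Then **`(T × T, η × (−η))` is of Weil type
relative to `E` with `dim_E H¹ = 2k`: `IsWeilTypeCM (T × T) (η × (−η)) R e₀ k`** (Deligne (4.4): `a_σ = k` at every embedding). Proof: `R` kills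
`(η × (−η))²` (§1); `dim(T × T) = 2k·e₀`; at a root `ρ` of `R(T²)`, `a_ρ(T × T̄) = a_ρ(T) + a_{−ρ}(T) = a_ρ(T) + a_ρ̄(T)` (§2, `ρ̄ = −ρ`), which is
`dim_E H¹(T) = 2 dim T/[E:ℚ] = k` by Moonen–Zarhin's `n_σ + n_σ̄ = 2g/[E:ℚ]` (the tree's `eigenMultiplicity_add_eigenMultiplicity_conj_eq`). The
imaginary-quadratic case in van Geemen's language is part O-a's `isWeilType_twistedSquare`; for products of CM-type realisations with constant sum
this is the tree's `AndreSplit.isWeilTypeCM_diagHom`. [cite: Deligne1982HodgeCycles, §4 (4.4), Prop. 4.4 and §5 (c) p. 38]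
[cite: MoonenZarhin1998WeilClasses, §1 (n_σ + n_σ' = 2g/[F:ℚ])] [cite: vanGeemen1994HodgeAV, 4.9] -/
theorem isWeilTypeCM_twistedSquare (he : 0 < e₀) (hk : 0 < k) (hRm : R.Monic) (hRe : R.natDegree = e₀)
    (hirr : Irreducible ((R.comp (X ^ 2)).map (Int.castRingHom ℚ)))
    (hroots : ∀ s : ℂ, Polynomial.eval₂ (Int.castRingHom ℂ) s R = 0 → s.im = 0 ∧ s.re < 0)
    (hη : Polynomial.eval₂ (Int.castRingHom (CategoryTheory.End T)) (η : CategoryTheory.End T) (R.comp (X ^ 2)) = 0)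
    (hT : T.dim = k * e₀) :
    IsWeilTypeCM (T.prod T)
      (AbelianVariety.prodLift (AbelianVariety.fst T T ≫ η) (AbelianVariety.snd T T ≫ (-η))) R e₀ k := by
  have hPm : (R.comp (X ^ 2)).Monic :=
    hRm.comp (Polynomial.monic_X_pow 2) (by rw [Polynomial.natDegree_X_pow]; exact two_ne_zero)
  have hPe : (R.comp (X ^ 2)).natDegree = 2 * e₀ := by
    rw [Polynomial.natDegree_comp, Polynomial.natDegree_X_pow, hRe, mul_comm]
  have hdim : (T.prod T).dim = 2 * k * e₀ := by rw [AbelianVariety.dim_prod, hT]; ring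
  refine ⟨he, hk, hRm, hRe, hirr, hroots, eval₂_twistedSquare_comp_X_sq_eq_zero hη, hdim, fun ρ hρ => ?_⟩
  have her : 2 * e₀ * k = 2 * T.dim := by rw [hT]; ring
  have hsum := eigenMultiplicity_add_eigenMultiplicity_conj_eq hPm hPe hirr hη her hρ
  rw [conj_eq_neg_of_root_of_roots_real_neg hroots hρ] at hsum
  rw [eigenMultiplicity_twistedSquare, hsum]

/-- **In particular for `T` itself of Weil type**: `IsWeilTypeCM T η R e₀ k ⟹ IsWeilTypeCM (T × T) (η × (−η)) R e₀ (2k)` (`dim T = 2k·e₀`; the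
conjugate structure on the second factor). [cite: Deligne1982HodgeCycles, §4 (4.4) and Prop. 4.4] [cite: MoonenZarhin1999LowDim, (1.9)] -/
theorem isWeilTypeCM_twistedSquare_of_isWeilTypeCM (hW : IsWeilTypeCM T η R e₀ k) :
    IsWeilTypeCM (T.prod T)
      (AbelianVariety.prodLift (AbelianVariety.fst T T ≫ η) (AbelianVariety.snd T T ≫ (-η))) R e₀ (2 * k) :=
  isWeilTypeCM_twistedSquare hW.e₀_pos (by have := hW.k_pos; omega) hW.monic hW.natDegree_eq hW.irreducible hW.root_real_neg
    hW.eval₂_eq_zero hW.dim_eq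

/-- **The twisted square has even `E`-rank and dimension `2k·e₀`** (bookkeeping for the pencil rows: the relative dimension of a pencil through
a twisted-square chart). [cite: Deligne1982HodgeCycles, §4 (4.4)] -/
theorem dim_twistedSquare_eq (hT : T.dim = k * e₀) : (T.prod T).dim = 2 * k * e₀ := by
  rw [AbelianVariety.dim_prod, hT]; ring

end WeilType

/-! ## §4 Algebraic `E`-Weil classes at the twisted square when HC holds for `T × T`; the CM-field `B × B̄` in codimension two -/

section Anchors

variable {T S : AbelianVariety ℂ} {η : T ⟶ T} {ηS : S ⟶ S} {R : Polynomial ℤ} {e₀ k : ℕ}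

/-- **If the Hodge conjecture holds for `T × T`, ALL `E`-Weil classes of the twisted square `(T × T, η × (−η))` are algebraic**:
`W_E(T × T̄) ⊗ ℂ ⊆ N^k H^{2k}`. The twisted square is of Weil type (§3), so its Weil classes are of type `(k, k)` (Deligne Prop. 4.4 ⟸, the tree's
Moonen–Zarhin criterion) and span a rational subspace; HC makes the rational ones algebraic (the tree's
`IsWeilTypeCM.weilClassesField_le_algebraicClasses_of_hodgeConjectureFor`). [cite: Deligne1982HodgeCycles, §4 Prop. 4.4]
[cite: MoonenZarhin1998WeilClasses, §1 (Criterion)] -/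
theorem weilClassesField_twistedSquare_le_algebraicClasses_of_hodgeConjectureFor (he : 0 < e₀) (hk : 0 < k) (hRm : R.Monic)
    (hRe : R.natDegree = e₀) (hirr : Irreducible ((R.comp (X ^ 2)).map (Int.castRingHom ℚ)))
    (hroots : ∀ s : ℂ, Polynomial.eval₂ (Int.castRingHom ℂ) s R = 0 → s.im = 0 ∧ s.re < 0)
    (hη : Polynomial.eval₂ (Int.castRingHom (CategoryTheory.End T)) (η : CategoryTheory.End T) (R.comp (X ^ 2)) = 0)
    (hT : T.dim = k * e₀) (hHC : HodgeConjectureFor (T.prod T).dim (T.prod T).X) :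
    weilClassesField (T.prod T)
        (AbelianVariety.prodLift (AbelianVariety.fst T T ≫ η) (AbelianVariety.snd T T ≫ (-η))) (R.comp (X ^ 2)) (2 * k) ≤
      algebraicClasses (T.prod T).X k :=
  (isWeilTypeCM_twistedSquare he hk hRm hRe hirr hroots hη hT).weilClassesField_le_algebraicClasses_of_hodgeConjectureFor hHC

/-- **HC for `(S × S) × (S × S)` when `S` is stably nondegenerate** (`(S²)² ∼ S⁴` by the tree's regrouping isogeny, and `Hdg = Div` on every power
of `S`). [cite: Gordon1999HodgeAVSurvey, Thm. 7.5 (1) and Def. 7.6] [cite: MumfordAV1970, §19] -/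
theorem hodgeConjectureFor_sq_prod_sq_of_isStablyNondegenerate (hS : IsStablyNondegenerate S) :
    HodgeConjectureFor ((S.prod S).prod (S.prod S)).dim ((S.prod S).prod (S.prod S)).X :=
  hS.hodgeConjectureFor_of_isIsogenous_powSucc (N := 1 + 1 * (1 + 1)) (isIsogenous_powSucc_powSucc S 1 1)

/-- **THE CM-FIELD `B × B̄` IN CODIMENSION TWO.** Let `E = ℚ[T]/(R(T²))` be a CM field of degree `2e₀` (`R` monic of degree `e₀ ≥ 1`, roots real
negative, `R(T²)` irreducible over `ℚ`) and `S` a STABLY NONDEGENERATE complex abelian variety of dimension `e₀` with `η_S : S ⟶ S`, `R(η_S²) = 0`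
(e.g. a simple CM abelian variety of PRIME dimension `e₀` with CM by `E`: Yanai, `…_of_endField_prime` below). Put `T = S × S` with the diagonal
`η = η_S ⊕ η_S`. Then the `4e₀`-fold `T × T̄ = (S × S) × (S × S)` with `η × (−η)` **is of Weil type relative to `E` with `dim_E H¹ = 4`
(`IsWeilTypeCM … R e₀ 2`), satisfies the HODGE CONJECTURE, and has ALL its `E`-Weil classes `W_E ⊗ ℂ ⊂ H⁴` (CODIMENSION 2) algebraic.** For `e₀ = 2`
(`S` a simple CM abelian SURFACE with quartic CM field, Galois or not) this is the EIGHTFOLD `S² × S̄²` — ring2-b03's census member `B² × (B^ρ)²`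
(`exists_cmEightfold_hodgeConjectureFor_of_isCyclic_four`, `…_of_not_isGalois_four`), here presentation-free (one endomorphism, no CM type).
[cite: Deligne1982HodgeCycles, §4 (4.4), Prop. 4.4 and §5 (c) p. 38] [cite: Gordon1999HodgeAVSurvey, Thm. 6.3 with Remark and Def. 7.6] [cite: Yanai1985, Remark (p. 172)] -/
theorem isWeilTypeCM_and_hodge_twistedSquare_prod_of_isStablyNondegenerate (he : 0 < e₀) (hRm : R.Monic) (hRe : R.natDegree = e₀)
    (hirr : Irreducible ((R.comp (X ^ 2)).map (Int.castRingHom ℚ)))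
    (hroots : ∀ s : ℂ, Polynomial.eval₂ (Int.castRingHom ℂ) s R = 0 → s.im = 0 ∧ s.re < 0)
    (hηS : Polynomial.eval₂ (Int.castRingHom (CategoryTheory.End S)) (ηS : CategoryTheory.End S) (R.comp (X ^ 2)) = 0)
    (hS : S.dim = e₀) (hSt : IsStablyNondegenerate S) :
    IsWeilTypeCM ((S.prod S).prod (S.prod S))
        (AbelianVariety.prodLift
          (AbelianVariety.fst (S.prod S) (S.prod S) ≫
            AbelianVariety.prodLift (AbelianVariety.fst S S ≫ ηS) (AbelianVariety.snd S S ≫ ηS))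
          (AbelianVariety.snd (S.prod S) (S.prod S) ≫
            (-AbelianVariety.prodLift (AbelianVariety.fst S S ≫ ηS) (AbelianVariety.snd S S ≫ ηS)))) R e₀ 2 ∧
      HodgeConjectureFor ((S.prod S).prod (S.prod S)).dim ((S.prod S).prod (S.prod S)).X ∧
      weilClassesField ((S.prod S).prod (S.prod S))
          (AbelianVariety.prodLift
            (AbelianVariety.fst (S.prod S) (S.prod S) ≫
              AbelianVariety.prodLift (AbelianVariety.fst S S ≫ ηS) (AbelianVariety.snd S S ≫ ηS))
            (AbelianVariety.snd (S.prod S) (S.prod S) ≫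
              (-AbelianVariety.prodLift (AbelianVariety.fst S S ≫ ηS) (AbelianVariety.snd S S ≫ ηS))))
          (R.comp (X ^ 2)) (2 * 2) ≤
        algebraicClasses ((S.prod S).prod (S.prod S)).X 2 := by
  have hT : (S.prod S).dim = 2 * e₀ := by rw [AbelianVariety.dim_prod, hS]; ring
  have hη := eval₂_diagSquare_comp_X_sq_eq_zero hηS
  have hHC := hodgeConjectureFor_sq_prod_sq_of_isStablyNondegenerate hSt
  exact ⟨isWeilTypeCM_twistedSquare he two_pos hRm hRe hirr hroots hη hT, hHC,
    weilClassesField_twistedSquare_le_algebraicClasses_of_hodgeConjectureFor he two_pos hRm hRe hirr hroots hη hT hHC⟩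

/-- **Supply: PRIME dimension with a number field of degree `2 dim S` in `End⁰(S)`** (a simple CM abelian variety of prime dimension; `E^p`):
`S` is stably nondegenerate UNCONDITIONALLY (Yanai's nondegeneracy / Tate–Murasaki, the tree's `EndFieldFullDegree.isStablyNondegenerate_of_prime`),
so the conclusions of `isWeilTypeCM_and_hodge_twistedSquare_prod_of_isStablyNondegenerate` hold for every `E`-structure `η_S` on `S` with
`R(η_S²) = 0`, `dim S = e₀` prime. [cite: Gordon1999HodgeAVSurvey, Thm. 6.3 with Remark, Thm. 6.4, Thm. 7.5 (1) and Def. 7.6] [cite: Yanai1985, Remark (p. 172)] -/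
theorem isWeilTypeCM_and_hodge_twistedSquare_prod_of_endField_prime {F : Type} [Field F] [NumberField F]
    (ιF : F →+* S.endAlgebra) (hF : Module.finrank ℚ F = 2 * S.dim) (hp : S.dim.Prime)
    (hRm : R.Monic) (hRe : R.natDegree = e₀) (hirr : Irreducible ((R.comp (X ^ 2)).map (Int.castRingHom ℚ)))
    (hroots : ∀ s : ℂ, Polynomial.eval₂ (Int.castRingHom ℂ) s R = 0 → s.im = 0 ∧ s.re < 0)
    (hηS : Polynomial.eval₂ (Int.castRingHom (CategoryTheory.End S)) (ηS : CategoryTheory.End S) (R.comp (X ^ 2)) = 0)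
    (hS : S.dim = e₀) :
    IsWeilTypeCM ((S.prod S).prod (S.prod S))
        (AbelianVariety.prodLift
          (AbelianVariety.fst (S.prod S) (S.prod S) ≫
            AbelianVariety.prodLift (AbelianVariety.fst S S ≫ ηS) (AbelianVariety.snd S S ≫ ηS))
          (AbelianVariety.snd (S.prod S) (S.prod S) ≫
            (-AbelianVariety.prodLift (AbelianVariety.fst S S ≫ ηS) (AbelianVariety.snd S S ≫ ηS)))) R e₀ 2 ∧
      HodgeConjectureFor ((S.prod S).prod (S.prod S)).dim ((S.prod S).prod (S.prod S)).X ∧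
      weilClassesField ((S.prod S).prod (S.prod S))
          (AbelianVariety.prodLift
            (AbelianVariety.fst (S.prod S) (S.prod S) ≫
              AbelianVariety.prodLift (AbelianVariety.fst S S ≫ ηS) (AbelianVariety.snd S S ≫ ηS))
            (AbelianVariety.snd (S.prod S) (S.prod S) ≫
              (-AbelianVariety.prodLift (AbelianVariety.fst S S ≫ ηS) (AbelianVariety.snd S S ≫ ηS))))
          (R.comp (X ^ 2)) (2 * 2) ≤
        algebraicClasses ((S.prod S).prod (S.prod S)).X 2 :=
  isWeilTypeCM_and_hodge_twistedSquare_prod_of_isStablyNondegenerate (by rw [← hS]; exact hp.pos) hRm hRe hirr hroots hηS hS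
    (EndFieldFullDegree.isStablyNondegenerate_of_prime ιF hF hp)

end Anchors

end Summit.HodgeConjecture.HodgeConjecture.Ring2.AbelianAll

end
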